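import Literature.NumberTheory.Transcendental.CalegariDimitrovTangL2Chi3
import Mathlib.Data.Nat.Choose.Central
import Mathlib.Algebra.BigOperators.Intervals
import Mathlib.Tactic
import HarnessLib

/-!
# Calegari–Dimitrov–Tang, Theorem 1 — proof-side file (bottom-up bricks of the printed proof)

Sibling of `CalegariDimitrovTangL2Chi3.lean` (the named fact
`Literature.NumberTheory.Transcendental.calegariDimitrovTang_linearIndependent`, CDT 2024 Thm. 1:
`1, π², L(2, χ₋₃)` are `ℚ`-linearly independent). The printed proof (arXiv:2408.15403, §13,
pp. 106–107) refutes a relation `a + b·L(2,χ₋₃)/2 + c·ζ(2)/4 = 0` by an *arithmetic holonomy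
bound* (Thm. "main: elementary form", §6, or the Bost–Charles form, §7) applied to `m = 14`
`ℚ(y)`-linearly independent `G`-functions built from Zagier's `Γ₀(6)` data (§§9–12) and an
explicit conformal map (§16), arriving at `m ≤ 13.730… < 14`. Everything in this file is PROVED;
it collects, in the printed order, the inputs of that proof that Mathlib + Literature can already
support. Nothing here is a new named fact (D-0026).

## Contents

* **Denominator growth (§2.2) is already in the tree.** CDT measure denominators by *types*
  `A^{n+1} [1,…,bn]^σ` (eq. (integrality)), `[1,…,n] := lcm(1,…,n)`, and every holonomy bound of
  the paper carries the rate `τ = bσ` in its denominator `log |φ'(0)| − τ`, which presumes the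
  prime number theorem in the form `[1,…,bn]^σ = e^{bσ·n + o(n)}`. This is
  `Literature.NumberTheory.Transcendental.tendsto_log_lcmUpto_div` and
  `Literature.NumberTheory.Transcendental.eventually_lcmUpto_mul_pow_le_exp`
  (`ZetaLinearFormsCriterion.lean`, proved from the tree's PNT) — not restated here.
* **Zagier's sequence C (§11.1).** `zagierC n = Σ_k C(n,k)² C(2k,k)` = CDT's `a_n`, the Taylor
  coefficients of `H_A(x) = 1 + 3x + 15x² + 93x³ + ⋯` (values `zagierC_zero` … `zagierC_three`),
  and **Zagier's recurrence** `(n+1)² a_{n+1} − (10n² + 10n + 3) a_n + 9n² a_{n−1} = 0`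
  (`zagierC_rec`, `zagierC_rec'`; eq. (zagr) with `(A,B,λ) = (10,9,3)`), i.e. the Picard–Fuchs
  equation of Prop. "functionsH" for `H_A`, proved by an explicit creative-telescoping certificate
  (`zagierCCert`, `zagierC_summand_eq`).
* **`b_n`, `c_n` and Prop. "functionsH" in coefficient form (§11.1).** `hB`, `hC` defined by
  the printed recurrences ((zagr) for `n ≠ 0`, resp. (zagrABC)) from `b_0 = c_0 = 0`,
  `b_1 = c_1 = 1`; the printed expansions of `H_B`, `H_C` (`hB_values`, `hC_values`); and the
  recurrence satisfied by `aH_A + bH_B + cH_C`, i.e. the ODE of Prop. "functionsH" with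
  right-hand side `b + c/(1−x)` read coefficient-wise (`functionsH_rec`, `functionsH_row_zero`).

Not here (yet): `H_B`, `H_C` and their denominator types `[1,…,n]²` (Zagier/Beukers, via the
`Γ₀(6)` modular parametrisation or Beukers-type double integrals), the symmetrisation `G(y)`,
the 14-function independence, the holonomy bounds and the contour numerics of §16 — i.e. the
substance of the proof; see the seat's NOTES for the dependency map.

## References

* [CalegariDimitrovTang2024] F. Calegari, V. Dimitrov, Y. Tang, *The linear independence of `1`,
  `ζ(2)`, and `L(2,χ₋₃)`*, arXiv:2408.15403, §2.2 (denominator types), §11.1 (Zagier's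
  sequences), §13 (proof of Thm. 1).
* D. Zagier, *Integral solutions of Apéry-like recurrence equations*, in: Groups and Symmetries,
  CRM Proc. Lecture Notes 47 (2009), 349–366 (sequences A, C; cited through CDT §11.1).
-/

open Finset

namespace Literature.NumberTheory.Transcendental

namespace CalegariDimitrovTang

/-! ### Zagier's sporadic sequence `C` = CDT's `a_n`, and its Apéry-like recurrence (§11.1)

CDT §11.1 (Lemma defining `H_A, H_B, H_C`, and its proof): the Taylor coefficients `a_n` of
`H_A(x) = A(q(x)) = 1 + 3x + 15x² + 93x³ + ⋯` are Zagier's sporadic sequence **C**,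
`a_n = Σ_k C(n,k)² C(2k,k)`, and satisfy Zagier's recurrence (eq. "zagr")
`(n+1)² a_{n+1} − (A n(n+1) + λ) a_n + B n² a_{n−1} = 0` with `(A, B, λ) = (10, 9, 3)`; this
recurrence is the coefficient form of the Picard–Fuchs equation
`x(1−x)(1−9x) y'' + (1 − 20x + 27x²) y' + 3(3x − 1) y = 0` of Prop. "functionsH" (the ODE that
`H(x) = aH_A + bH_B + cH_C` satisfies with right-hand side `b + c/(1−x)`). CDT read these off
Zagier (2009) and Beukers; here the recurrence is proved from the binomial sum by an explicit
creative-telescoping certificate `G(n,k) = −k(4n − 3k + 4)·C(n,k−1)²·C(2k,k)`: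
`9n² F(n−1,k) − (10n²+10n+3) F(n,k) + (n+1)² F(n+1,k) = G(n,k+1) − G(n,k)` for
`F(n,k) = C(n,k)² C(2k,k)` (checked symbolically case by case below), summed over `k`. -/

/-- **CDT's `a_n` = Zagier's sporadic Apéry-like sequence C**: `a_n = Σ_{k=0}^{n} C(n,k)² C(2k,k)`
(`1, 3, 15, 93, 639, 4653, …`), the Taylor coefficients of `H_A(x) = A(q(x))` (the weight-one
`Γ₀(6)` Eisenstein series `A = (θ₋₃(τ) + θ₋₃(2τ))/2` in the Hauptmodul `x` of `Y₀(6)`); *defined*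
here by the binomial sum printed in the proof of the Lemma of §11.1 ("`a_n` is none other than
Zagier's sequence C … `a_n = Σ_k C(n,k)² C(2k,k)`").
[cite: CalegariDimitrovTang2024, §11.1 (pp. 100–101)] -/
def zagierC (n : ℕ) : ℕ :=
  ∑ k ∈ Finset.range (n + 1), n.choose k ^ 2 * (2 * k).choose k

/-- `a_0 = 1` (`H_A(x) = 1 + 3x + 15x² + 93x³ + ⋯`).
[cite: CalegariDimitrovTang2024, §11.1 (p. 101)] -/
theorem zagierC_zero : zagierC 0 = 1 := by
  simp [zagierC]

/-- `a_1 = 3`. [cite: CalegariDimitrovTang2024, §11.1 (p. 101)] -/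
theorem zagierC_one : zagierC 1 = 3 := by
  simp [zagierC, Finset.sum_range_succ]

/-- `a_2 = 15`. [cite: CalegariDimitrovTang2024, §11.1 (p. 101)] -/
theorem zagierC_two : zagierC 2 = 15 := by
  simp [zagierC, Finset.sum_range_succ, Nat.choose]

/-- `a_3 = 93`. [cite: CalegariDimitrovTang2024, §11.1 (p. 101)] -/
theorem zagierC_three : zagierC 3 = 93 := by
  simp [zagierC, Finset.sum_range_succ, Nat.choose]

/-- The binomial sum for `a_n` may be taken over any range `[0, N)` with `N > n` (the extra terms
vanish), cast to `ℚ`. [folklore] -/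
theorem zagierC_eq_sum_range {n N : ℕ} (h : n + 1 ≤ N) :
    (zagierC n : ℚ) = ∑ k ∈ Finset.range N, (n.choose k : ℚ) ^ 2 * ((2 * k).choose k : ℚ) := by
  unfold zagierC
  push_cast
  apply Finset.sum_subset (Finset.range_subset_range.mpr h)
  intro k _ hk'
  have hnk : n < k := by
    simp only [Finset.mem_range, not_lt] at hk'
    omega
  simp [Nat.choose_eq_zero_of_lt hnk]

/-- The creative-telescoping certificate for Zagier's recurrence, row `n+1`:
`G(n+1, k) = −k(4(n+1) − 3k + 4)·C(n+1,k−1)²·C(2k,k)` (as a rational number; the factor `k`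
kills the `k = 0` term, where `k − 1` is truncated). [folklore] -/
def zagierCCert (n k : ℕ) : ℚ :=
  -(k : ℚ) * (4 * n - 3 * k + 8) * ((n + 1).choose (k - 1) : ℚ) ^ 2 * ((2 * k).choose k : ℚ)

/-- `G(n+1, 0) = 0` (the factor `k`). [folklore] -/
theorem zagierCCert_zero (n : ℕ) : zagierCCert n 0 = 0 := by
  simp [zagierCCert]

/-- `G(n+1, n+3) = 0` (the factor `C(n+1, n+2) = 0`). [folklore] -/
theorem zagierCCert_add_three (n : ℕ) : zagierCCert n (n + 3) = 0 := by
  simp [zagierCCert]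

/-- The step `(k+1)·C(2k+2,k+1) = 2(2k+1)·C(2k,k)` of the central binomial coefficients, in `ℚ`.
[folklore] -/
theorem succ_mul_choose_two_mul_succ (k : ℕ) :
    ((k : ℚ) + 1) * ((2 * (k + 1)).choose (k + 1) : ℚ)
      = 2 * (2 * k + 1) * ((2 * k).choose k : ℚ) := by
  have h := Nat.succ_mul_centralBinom_succ k
  rw [Nat.centralBinom_eq_two_mul_choose, Nat.centralBinom_eq_two_mul_choose] at h
  exact_mod_cast h

/-- **The telescoping identity** behind Zagier's recurrence for sequence C (row `n+1`, all `k`):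
`9(n+1)² F(n,k) − (10(n+1)² + 10(n+1) + 3) F(n+1,k) + (n+2)² F(n+2,k) = G(n+1,k+1) − G(n+1,k)`,
`F(n,k) = C(n,k)² C(2k,k)`. [folklore] -/
theorem zagierC_summand_eq (n k : ℕ) :
    9 * ((n : ℚ) + 1) ^ 2 * ((n.choose k : ℚ) ^ 2 * ((2 * k).choose k : ℚ))
      - (10 * ((n : ℚ) + 1) ^ 2 + 10 * ((n : ℚ) + 1) + 3)
          * (((n + 1).choose k : ℚ) ^ 2 * ((2 * k).choose k : ℚ))
      + ((n : ℚ) + 2) ^ 2 * (((n + 2).choose k : ℚ) ^ 2 * ((2 * k).choose k : ℚ))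
    = zagierCCert n (k + 1) - zagierCCert n k := by
  have hP := succ_mul_choose_two_mul_succ k
  -- normalise the certificate at `k+1`
  have hc1 : zagierCCert n (k + 1) =
      -((k : ℚ) + 1) * (4 * n - 3 * k + 5) * ((n + 1).choose k : ℚ) ^ 2
        * ((2 * (k + 1)).choose (k + 1) : ℚ) := by
    simp only [zagierCCert, Nat.add_sub_cancel]
    push_cast
    ring
  rw [hc1]
  rcases Nat.lt_or_ge n k with hnk | hkn
  · -- `k ≥ n+1`: the two boundary cases and the vanishing tail
    obtain rfl | rfl | hk3 : k = n + 1 ∨ k = n + 2 ∨ n + 3 ≤ k := by omega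
    · -- `k = n+1`
      have hP' : ((2 * (n + 1 + 1)).choose (n + 1 + 1) : ℚ) =
          2 * (2 * ((n : ℚ) + 1) + 1) * ((2 * (n + 1)).choose (n + 1) : ℚ) / ((n : ℚ) + 1 + 1) := by
        rw [eq_div_iff (by positivity)]
        have hP2 := succ_mul_choose_two_mul_succ (n + 1)
        push_cast at hP2
        linear_combination hP2
      have h1 : n.choose (n + 1) = 0 := Nat.choose_succ_self n
      have h2 : (n + 1).choose (n + 1) = 1 := Nat.choose_self _
      have h3 : (n + 2).choose (n + 1) = n + 2 := Nat.choose_succ_self_right (n + 1)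
      have h4 : (n + 1).choose (n + 1 - 1) = n + 1 := by
        rw [Nat.add_sub_cancel]; exact Nat.choose_succ_self_right n
      simp only [zagierCCert, h1, h2, h3, h4, hP']
      push_cast
      field_simp
      ring
    · -- `k = n+2`
      have h1 : n.choose (n + 2) = 0 := Nat.choose_eq_zero_of_lt (by omega)
      have h2 : (n + 1).choose (n + 2) = 0 := Nat.choose_eq_zero_of_lt (by omega)
      have h3 : (n + 2).choose (n + 2) = 1 := Nat.choose_self _
      have h4 : (n + 1).choose (n + 2 - 1) = 1 := by
        rw [show n + 2 - 1 = n + 1 by omega]; exact Nat.choose_self _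
      simp only [zagierCCert, h1, h2, h3, h4]
      push_cast
      ring
    · -- `k ≥ n+3`: everything vanishes
      have h1 : n.choose k = 0 := Nat.choose_eq_zero_of_lt (by omega)
      have h2 : (n + 1).choose k = 0 := Nat.choose_eq_zero_of_lt (by omega)
      have h3 : (n + 2).choose k = 0 := Nat.choose_eq_zero_of_lt (by omega)
      have h4 : (n + 1).choose (k - 1) = 0 := Nat.choose_eq_zero_of_lt (by omega)
      simp [zagierCCert, h1, h2, h3, h4]
  · -- `k ≤ n`
    rcases Nat.eq_zero_or_pos k with rfl | hk1
    · -- `k = 0`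
      norm_num [zagierCCert]
      ring
    · -- `1 ≤ k ≤ n`: the generic hypergeometric case, everything is a multiple of `C(n+1,k)`
      have hkq : (k : ℚ) ≤ n := by exact_mod_cast hkn
      have hne : ((n : ℚ) + 2 - k) ≠ 0 := by linarith
      set B : ℚ := ((n + 1).choose k : ℚ) with hB
      -- `C(n,k)·(n+1) = C(n+1,k)·(n+1-k)`
      have e1 : (n.choose k : ℚ) = B * ((n : ℚ) + 1 - k) / ((n : ℚ) + 1) := by
        rw [eq_div_iff (by positivity)]
        have h := Nat.choose_mul_succ_eq n k
        have h' : ((n.choose k : ℕ) : ℚ) * ((n + 1 : ℕ) : ℚ) =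
            (((n + 1).choose k : ℕ) : ℚ) * ((n + 1 - k : ℕ) : ℚ) := by
          exact_mod_cast h
        rw [Nat.cast_sub (by omega)] at h'
        push_cast at h'
        linear_combination h'
      -- `C(n+1,k)·(n+2) = C(n+2,k)·(n+2-k)`
      have e2 : ((n + 2).choose k : ℚ) = B * ((n : ℚ) + 2) / ((n : ℚ) + 2 - k) := by
        rw [eq_div_iff hne]
        have h := Nat.choose_mul_succ_eq (n + 1) k
        have h' : (((n + 1).choose k : ℕ) : ℚ) * ((n + 1 + 1 : ℕ) : ℚ) =
            (((n + 1 + 1).choose k : ℕ) : ℚ) * ((n + 1 + 1 - k : ℕ) : ℚ) := by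
          exact_mod_cast h
        rw [Nat.cast_sub (by omega)] at h'
        push_cast at h'
        linear_combination -h'
      -- `C(n+1,k)·k = C(n+1,k-1)·(n+2-k)`
      have e3 : ((n + 1).choose (k - 1) : ℚ) = B * k / ((n : ℚ) + 2 - k) := by
        rw [eq_div_iff hne]
        have h := Nat.choose_succ_right_eq (n + 1) (k - 1)
        rw [Nat.sub_add_cancel hk1] at h
        have h' : (((n + 1).choose k : ℕ) : ℚ) * ((k : ℕ) : ℚ) =
            (((n + 1).choose (k - 1) : ℕ) : ℚ) * ((n + 1 - (k - 1) : ℕ) : ℚ) := by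
          exact_mod_cast h
        rw [Nat.cast_sub (by omega), Nat.cast_sub hk1] at h'
        push_cast at h'
        linear_combination -h'
      -- central binomial step
      have e4 : ((2 * (k + 1)).choose (k + 1) : ℚ) =
          2 * (2 * k + 1) * ((2 * k).choose k : ℚ) / ((k : ℚ) + 1) := by
        rw [eq_div_iff (by positivity)]
        linear_combination hP
      simp only [zagierCCert]
      rw [e1, e2, e3, e4]
      field_simp
      ring

/-- **Zagier's recurrence for the sporadic sequence C** (`(A, B, λ) = (10, 9, 3)` in
`(n+1)² a_{n+1} − (A n(n+1) + λ) a_n + B n² a_{n−1} = 0`), written on row `n+1` so that no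
subtraction of indices occurs:
`(n+2)² a_{n+2} − (10(n+1)² + 10(n+1) + 3) a_{n+1} + 9(n+1)² a_n = 0` for all `n ≥ 0`.
This is the coefficient recurrence of the Picard–Fuchs operator
`x(1−x)(1−9x)D² + (1 − 20x + 27x²)D + 3(3x − 1)` annihilating `H_A(x) = Σ a_n xⁿ`.
[cite: CalegariDimitrovTang2024, §11.1, eq. (zagr) with (A,B,λ) = (10,9,3) (p. 101)] -/
theorem zagierC_rec (n : ℕ) :
    ((n : ℤ) + 2) ^ 2 * zagierC (n + 2)
      - (10 * ((n : ℤ) + 1) ^ 2 + 10 * ((n : ℤ) + 1) + 3) * zagierC (n + 1)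
      + 9 * ((n : ℤ) + 1) ^ 2 * zagierC n = 0 := by
  have hq : ((n : ℚ) + 2) ^ 2 * (zagierC (n + 2) : ℚ)
      - (10 * ((n : ℚ) + 1) ^ 2 + 10 * ((n : ℚ) + 1) + 3) * (zagierC (n + 1) : ℚ)
      + 9 * ((n : ℚ) + 1) ^ 2 * (zagierC n : ℚ) = 0 := by
    rw [zagierC_eq_sum_range (le_refl (n + 2 + 1)),
      zagierC_eq_sum_range (by omega : n + 1 + 1 ≤ n + 3),
      zagierC_eq_sum_range (by omega : n + 1 ≤ n + 3),
      Finset.mul_sum, Finset.mul_sum, Finset.mul_sum, ← Finset.sum_sub_distrib,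
      ← Finset.sum_add_distrib]
    calc ∑ k ∈ Finset.range (n + 3),
          (((n : ℚ) + 2) ^ 2 * ((((n + 2).choose k : ℕ) : ℚ) ^ 2 * (((2 * k).choose k : ℕ) : ℚ))
            - (10 * ((n : ℚ) + 1) ^ 2 + 10 * ((n : ℚ) + 1) + 3)
                * ((((n + 1).choose k : ℕ) : ℚ) ^ 2 * (((2 * k).choose k : ℕ) : ℚ))
            + 9 * ((n : ℚ) + 1) ^ 2 * (((n.choose k : ℕ) : ℚ) ^ 2 * (((2 * k).choose k : ℕ) : ℚ)))
        = ∑ k ∈ Finset.range (n + 3), (zagierCCert n (k + 1) - zagierCCert n k) := by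
          refine Finset.sum_congr rfl fun k _ => ?_
          rw [← zagierC_summand_eq n k]
          ring
      _ = 0 := by
          rw [Finset.sum_range_sub, zagierCCert_zero, zagierCCert_add_three, sub_zero]
  exact_mod_cast hq

/-- Zagier's recurrence in the printed indexing: for `n ≥ 1`,
`(n+1)² a_{n+1} − (10n² + 10n + 3) a_n + 9n² a_{n−1} = 0`.
[cite: CalegariDimitrovTang2024, §11.1, eq. (zagr), (A,B,λ) = (10,9,3) (p. 101)] -/
theorem zagierC_rec' {n : ℕ} (hn : 1 ≤ n) :
    ((n : ℤ) + 1) ^ 2 * zagierC (n + 1) - (10 * (n : ℤ) ^ 2 + 10 * n + 3) * zagierC n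
      + 9 * (n : ℤ) ^ 2 * zagierC (n - 1) = 0 := by
  obtain ⟨m, rfl⟩ : ∃ m, n = m + 1 := ⟨n - 1, by omega⟩
  have h := zagierC_rec m
  simp only [Nat.add_sub_cancel]
  push_cast at h ⊢
  linear_combination h

/-! ### The sequences `b_n`, `c_n` and the recurrence form of Prop. "functionsH" (§11.1)

CDT define `H_B(x) = Σ b_n xⁿ` and `H_C(x) = Σ c_n xⁿ` through the `Γ₀(6)` modular
parametrisation (`H_B/H_A = B(q)`, `H_C/H_A = C(q)`, Eichler integrals of two weight-3
Eisenstein series) and record that `b_n` satisfies Zagier's recurrence (zagr) for all `n ≠ 0`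
while `c_n` satisfies `(n+1)² c_{n+1} − (10n² + 10n + 3) c_n + 9n² c_{n−1} = 1 + 0` i.e. eq.
(zagrABC), for all `n ≥ 0`. Since `(n+1)² ≠ 0`, these recurrences together with the printed
initial coefficients `b_0 = c_0 = 0`, `b_1 = c_1 = 1` determine the sequences; we *define* them
that way here (a deviation from the printed definition, which is what carries the deep
integrality `[1,…,n]² b_n, [1,…,n]² c_n ∈ ℤ` and the Apéry limits `b_n/a_n → L(2,χ₋₃)/2`,
`c_n/a_n → ζ(2)/4` — not proved here), and check the printed Taylor coefficients
`H_B = x + 23x²/4 + 145x³/4 + 3993x⁴/16 + ⋯`, `H_C = x + 6x² + 343x³/9 + 788x⁴/3 + ⋯`. -/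

/-- **CDT's `b_n`** (Taylor coefficients of `H_B(x)`), defined by Zagier's recurrence
`(n+2)² b_{n+2} = (10(n+1)² + 10(n+1) + 3) b_{n+1} − 9(n+1)² b_n` from `b_0 = 0`, `b_1 = 1`
(CDT: "`b_n` satisfies the same recurrence (zagr) for all `n ≠ 0`").
[cite: CalegariDimitrovTang2024, §11.1 (Lemma on `H_A, H_B, H_C` and its proof, p. 101)] -/
def hB : ℕ → ℚ
  | 0 => 0
  | 1 => 1
  | n + 2 => ((10 * ((n : ℚ) + 1) ^ 2 + 10 * ((n : ℚ) + 1) + 3) * hB (n + 1)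
      - 9 * ((n : ℚ) + 1) ^ 2 * hB n) / ((n : ℚ) + 2) ^ 2

/-- **CDT's `c_n`** (Taylor coefficients of `H_C(x)`), defined by the inhomogeneous recurrence
(zagrABC) `(n+1)² c_{n+1} − (10n² + 10n + 3) c_n + 9n² c_{n−1} = 1` (all `n ≥ 0`) from
`c_0 = 0` (so `c_1 = 1`). [cite: CalegariDimitrovTang2024, §11.1, eq. (zagrABC) (p. 101)] -/
def hC : ℕ → ℚ
  | 0 => 0
  | 1 => 1
  | n + 2 => (1 + (10 * ((n : ℚ) + 1) ^ 2 + 10 * ((n : ℚ) + 1) + 3) * hC (n + 1)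
      - 9 * ((n : ℚ) + 1) ^ 2 * hC n) / ((n : ℚ) + 2) ^ 2

/-- `H_B(x) = x + 23x²/4 + 145x³/4 + 3993x⁴/16 + ⋯` (the printed expansion).
[cite: CalegariDimitrovTang2024, §11.1 (p. 101)] -/
theorem hB_values : hB 0 = 0 ∧ hB 1 = 1 ∧ hB 2 = 23 / 4 ∧ hB 3 = 145 / 4 ∧ hB 4 = 3993 / 16 := by
  refine ⟨rfl, rfl, ?_, ?_, ?_⟩ <;> norm_num [hB]

/-- `H_C(x) = x + 6x² + 343x³/9 + 788x⁴/3 + ⋯` (the printed expansion).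
[cite: CalegariDimitrovTang2024, §11.1 (p. 101)] -/
theorem hC_values : hC 0 = 0 ∧ hC 1 = 1 ∧ hC 2 = 6 ∧ hC 3 = 343 / 9 ∧ hC 4 = 788 / 3 := by
  refine ⟨rfl, rfl, ?_, ?_, ?_⟩ <;> norm_num [hC]

/-- Zagier's recurrence for `b_n` on rows `n + 1 ≥ 1` (by definition).
[cite: CalegariDimitrovTang2024, §11.1, eq. (zagr) for `n ≠ 0` (p. 101)] -/
theorem hB_rec (n : ℕ) :
    ((n : ℚ) + 2) ^ 2 * hB (n + 2)
      - (10 * ((n : ℚ) + 1) ^ 2 + 10 * ((n : ℚ) + 1) + 3) * hB (n + 1)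
      + 9 * ((n : ℚ) + 1) ^ 2 * hB n = 0 := by
  rw [hB]
  field_simp
  ring

/-- Row `n = 0` for `b_n`: `1²·b_1 − 3·b_0 = 1` — the recurrence (zagr) fails exactly at `n = 0`,
with defect `1` (the constant term `b` of the right-hand side `b + c/(1−x)` of the ODE of
Prop. "functionsH"). [cite: CalegariDimitrovTang2024, §11.1, Prop. "functionsH" (p. 101)] -/
theorem hB_row_zero : (1 : ℚ) ^ 2 * hB 1 - 3 * hB 0 = 1 := by
  norm_num [hB]

/-- The inhomogeneous recurrence (zagrABC) for `c_n` on rows `n + 1 ≥ 1` (by definition).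
[cite: CalegariDimitrovTang2024, §11.1, eq. (zagrABC) (p. 101)] -/
theorem hC_rec (n : ℕ) :
    ((n : ℚ) + 2) ^ 2 * hC (n + 2)
      - (10 * ((n : ℚ) + 1) ^ 2 + 10 * ((n : ℚ) + 1) + 3) * hC (n + 1)
      + 9 * ((n : ℚ) + 1) ^ 2 * hC n = 1 := by
  rw [hC]
  field_simp
  ring

/-- Row `n = 0` of (zagrABC): `1²·c_1 − 3·c_0 = 1`.
[cite: CalegariDimitrovTang2024, §11.1, eq. (zagrABC) (p. 101)] -/
theorem hC_row_zero : (1 : ℚ) ^ 2 * hC 1 - 3 * hC 0 = 1 := by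
  norm_num [hC]

/-- **Prop. "functionsH" in coefficient form.** For any `a, b, c` the coefficients
`h_n = a·a_n + b·b_n + c·c_n` of `H(x) = aH_A(x) + bH_B(x) + cH_C(x)` satisfy
`(n+1)² h_{n+1} − (10n² + 10n + 3) h_n + 9n² h_{n−1} = c` for `n ≥ 1` and `h_1 − 3h_0 = b + c`
— the coefficient-wise reading of the ODE
`x(1−x)(1−9x)H'' + (1 − 20x + 27x²)H' + 3(3x − 1)H = b + c/(1−x) = (b+c) + cx + cx² + ⋯`
(coefficient of `xⁿ` on the left: `(n+1)² h_{n+1} − (10n² + 10n + 3) h_n + 9n² h_{n−1}`).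
In CDT, `(a, b, c)` is a putative rational relation `a + b·L(2,χ₋₃)/2 + c·ζ(2)/4 = 0`, which
makes `H` overconverge; that input is not used for the recurrence itself.
[cite: CalegariDimitrovTang2024, §11.1, Prop. "functionsH" (pp. 101–102)] -/
theorem functionsH_rec (a b c : ℚ) (n : ℕ) :
    ((n : ℚ) + 2) ^ 2 * (a * zagierC (n + 2) + b * hB (n + 2) + c * hC (n + 2))
      - (10 * ((n : ℚ) + 1) ^ 2 + 10 * ((n : ℚ) + 1) + 3)
          * (a * zagierC (n + 1) + b * hB (n + 1) + c * hC (n + 1))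
      + 9 * ((n : ℚ) + 1) ^ 2 * (a * zagierC n + b * hB n + c * hC n) = c := by
  have hA := zagierC_rec n
  have hA' : ((n : ℚ) + 2) ^ 2 * (zagierC (n + 2) : ℚ)
      - (10 * ((n : ℚ) + 1) ^ 2 + 10 * ((n : ℚ) + 1) + 3) * (zagierC (n + 1) : ℚ)
      + 9 * ((n : ℚ) + 1) ^ 2 * (zagierC n : ℚ) = 0 := by
    exact_mod_cast hA
  linear_combination a * hA' + b * hB_rec n + c * hC_rec n

/-- Row `n = 0` of Prop. "functionsH" in coefficient form: `h_1 − 3h_0 = b + c`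
(`a_0 = 1, a_1 = 3`, `b_0 = c_0 = 0`, `b_1 = c_1 = 1`).
[cite: CalegariDimitrovTang2024, §11.1, Prop. "functionsH" (pp. 101–102)] -/
theorem functionsH_row_zero (a b c : ℚ) :
    (1 : ℚ) ^ 2 * (a * zagierC 1 + b * hB 1 + c * hC 1) - 3 * (a * zagierC 0 + b * hB 0 + c * hC 0)
      = b + c := by
  norm_num [zagierC_zero, zagierC_one, hB, hC]
  ring

end CalegariDimitrovTang

end Literature.NumberTheory.Transcendental
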